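import Mathlib
import HarnessLib
import Literature.MathematicalPhysics.StatisticalMechanics.RenormalisationMapFreeHtRaw
import Literature.MathematicalPhysics.StatisticalMechanics.RenormalisationMapBlockDefectBlockFree
import Literature.MathematicalPhysics.StatisticalMechanics.RenormalisationMapTwoKernelWeak

/-!
# `‖nextK(μ_D; e^{−H}, e^{−H̃}, K) − S(H,K)‖_{k+1}^{(A)} ≤ Θ₁(‖H̃ − H_{k+1}‖)` — the free-`H̃` comparison of `K_{k+1}` with the
# renormalisation map in the WEAK norm, kernel level ([ABKM19] Theorem 6.8 ⊗ Lemma 9.3; block U1 of (12.53) at `ℓ = 2`)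

The weak-norm conversion of the five-piece bound (`RenormalisationMapFreeHtRaw`): on every connected `(k+1)`-polymer `U` the
`Σ₁`-variation and the defect are taken in block form (`RenormalisationMapRemainderOneBlockFree`, `RenormalisationMapBlockDefectBlockFree`:
`L^dκ₁^{L^d}[…]·A·A^{−|U|_{k+1}}`), and the three large-remainder `H̃`-variations carry `κ^{|U|_k}·c^{|U|_{k+1}}·A^{−η|U|_{k+1}}`,
absorbed by the counting conditions `hc3a/hc2a` (per-block constant `A_𝒫`) into `A^{−|U|_{k+1}}` exactly as in
`RenormalisationMapTwoKernelWeak`.  Every term of `Θ₁` carries the factor `Δ_t = 16e^{3/8}‖H̃ − H_{k+1}‖_{k,0}`, `H_{k+1} = nextH D H K`: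
on a ball `‖H̃ − H_{k+1}‖_{k,0} ≤ ρ₀` the free-`H̃` map is uniformly within `O(ρ₀)` of `S(H,K)` in `‖·‖_{k+1}^{(A)}`, hence uniformly
bounded — the uniform bound (U1) consumed by the Cauchy estimates of the blocks B1–B3 of the stub `stub_f4l2ShrinkLoc`.

* **`weakNormLE_nextK_freeHt_sub_nextKStep_abkm_of_stepKernelBounds`**.

Everything is proved; no named fact.  Honest scope: rung route `Summits/HubbardSuperconductivity/…/Theses/ComplexGFFStiffness`
(stiffness of a complex Gaussian gradient field via the [ABKM19] RG); nothing about superconductivity in the Hubbard model is claimed.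

## References
* S. Adams, S. Buchholz, R. Kotecký, S. Müller, arXiv:1910.13564, Theorem 6.8 ((6.59)–(6.60)), Lemma 9.3, Ch. 12 (12.4),
  Lemma 12.6 (12.53) [AdamsBuchholzKoteckyMuller2019].
-/

noncomputable section

namespace Literature.MathematicalPhysics.StatisticalMechanics.GradientRG

open scoped BigOperators Classical
open Finset MeasureTheory
open Literature.MathematicalPhysics.StatisticalMechanics.TorusPolymer
  (IsPolymer blocks polys bprod blockOf thicken reblock boxCorner mem_polys mem_blocks numBlocks isPolymer_blockOf
    card_blocks_eq_numBlocks blocks_blockOf empty_mem_polys closure mem_blockOf_self)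
open Literature.Barriers.CriticalPhenomena.LongRangePhi4.Polymer (IsConn components)
open Literature.MathematicalPhysics.StatisticalMechanics.GradientFRD (iterDiff)
open Literature.MathematicalPhysics.QuantumFieldTheory

variable {d M : ℕ} [NeZero M]

set_option maxHeartbeats 1600000 in
/-- **`‖nextK(μ_D; e^{−H}, e^{−H̃}, K) − nextKStep D H K‖_{k+1}^{(A)} ≤ Θ₁`** (module docstring): hypotheses of
`tayNormLE_nextK_freeHt_sub_nextKStep_abkm_raw_of_stepKernelBounds` plus the two counting conditions `hc3a`, `hc2a` of
[ABKM19] Ch. 12 (12.4) at the letter `κ` and per-block constant `A_𝒫`.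
[cite: AdamsBuchholzKoteckyMuller2019, Theorem 6.8 (6.59)–(6.60) / Lemma 9.3 / Lemma 12.6 (12.53)] -/
theorem weakNormLE_nextK_freeHt_sub_nextKStep_abkm_of_stepKernelBounds {L N Mord R n p r₀ : ℕ}
    {θbar lam μ δ₁ δ₀ A𝒫 A𝒫a C₂a h A : ℝ}
    {𝒞 : ℕ → (Fin d → ZMod M) → ℝ} (hd : 3 ≤ d) (hLodd : Odd L) (hL : 2 ^ (d + 3) + 16 * R ≤ L)
    (hR2 : 2 ≤ R) (hM : M = L ^ N) {k : ℕ} (hkN : k + 1 ≤ N)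
    (hp : d / 2 + 2 ≤ p) (hpM : p + d ≤ Mord) (hMR : Mord ≤ R) (hr₀ : 3 ≤ r₀)
    (hB : AbkmWeightBounds L N Mord R n θbar lam μ δ₁ δ₀ A𝒫 𝒞
      (abkmWeightData L N Mord R θbar (schedDelta δ₀ δ₁ N) 𝒞))
    (hδ₀ : 0 < δ₀) (hδ₁ : 0 < δ₁) (hh : 0 < h) (hh0 : hZeroSq d R δ₀ δ₁ ≤ h ^ 2)
    (hh2a : C₂a ≤ h ^ 2) (hA𝒫a : 0 ≤ A𝒫a) (hA1 : 1 ≤ A)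
    (D : StepData d M) (hDs : D.s = L ^ k) (hDL : D.L = L)
    (hS : StepKernelBounds (abkmWeightData L N Mord R θbar (schedDelta δ₀ δ₁ N) 𝒞) L k A𝒫a C₂a D.𝒞)
    {x₀ : Fin d → ZMod M} (hB₀ : D.B₀ = blockOf (L ^ k) x₀) (hc₀ : D.c₀ = boxCorner (L ^ k) (starRad R L d k) x₀)
    {H : RelevantHamiltonian ℂ d} {b : ℝ}
    (hH : hamNorm (fieldWt h (L : ℝ) d k) ((L : ℝ) ^ k) (L ^ (d * k)) H ≤ b) (hb : b ≤ 1 / 64)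
    {K : Finset (Fin d → ZMod M) → ((Fin d → ZMod M) → ℝ) → ℂ} {C : ℝ} (hC : 0 ≤ C)
    (hK : WeakNormLE (abkmNormParams L N Mord R p r₀ h θbar A (schedDelta δ₀ δ₁ N) 𝒞) k K C)
    (hKfac : Factorises (L ^ k) K) (hK0 : ∀ φ, K ∅ φ = 1) (hKd : ∀ Y, ContDiff ℝ r₀ (K Y))
    (hKloc : ∀ Y, IsPolymer (L ^ k) Y → IsConn Y →
      IsGaugeLocal ((abkmNormParams L N Mord R p r₀ h θbar A (schedDelta δ₀ δ₁ N) 𝒞).gauge k Y) (K Y))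
    (hva : pi2BoundConst d (((2 * R + 2 : ℕ) : ℝ) + ((d / 2 + 1 : ℕ) : ℝ)) * (C * A𝒫a * A⁻¹) ≤ 1 / 64)
    {τ : ℝ} (hτa : 2 * b + pi2BoundConst d (((2 * R + 2 : ℕ) : ℝ) + ((d / 2 + 1 : ℕ) : ℝ)) * (C * A𝒫a * A⁻¹) ≤ τ)
    (hτ : τ ≤ 1 / 16)
    {Ht : RelevantHamiltonian ℂ d} (hHt : hamNorm (fieldWt h (L : ℝ) d k) ((L : ℝ) ^ k) (L ^ (d * k)) Ht ≤ τ)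
    {ω κ κ₁ : ℝ}
    (hω1 : 8 * Real.exp (1 / 4) * τ +
      16 * Real.exp (3 / 8) * hamNorm (fieldWt h (L : ℝ) d k) ((L : ℝ) ^ k) (L ^ (d * k)) (Ht - nextH D H K) ≤ ω)
    (hω2 : 8 * Real.exp (1 / 4) * b + 8 * Real.exp (1 / 4) * b ≤ ω)
    (hω3 : C ≤ ω) (hωA : ω * A ^ 2 ≤ 1)
    (hκ : 1 + Real.exp (1 / 4) + 16 * Real.exp (3 / 8) * hamNorm (fieldWt h (L : ℝ) d k) ((L : ℝ) ^ k) (L ^ (d * k)) (Ht - nextH D H K) ≤ κ)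
    (hκ₁ : 1 + Real.exp (1 / 4) + 16 * Real.exp (3 / 8) * hamNorm (fieldWt h (L : ℝ) d k) ((L : ℝ) ^ k) (L ^ (d * k)) (Ht - nextH D H K) ≤ κ₁)
    (hκ₁' : 1 + Real.exp (1 / 4) + 16 * Real.exp (3 / 8) * τ ≤ κ₁)
    (hc3a : κ ^ (L ^ d) * ((2 * (2 * κ * max 1 A𝒫a)) ^ ((2 ^ (d + 1) + 2) ^ d * L ^ d) * (4 : ℝ) ^ ((2 ^ (d + 1) + 2) ^ d * L ^ d)) ≤ A ^ ((1 + 1 / ((2 * (2 ^ d + 1) + 6 : ℝ) ^ d)) - 1 : ℝ))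
    (hc2a : κ ^ (L ^ d) * ((2 * κ * max 1 A𝒫a) ^ ((2 ^ (d + 1) + 2) ^ d * L ^ d) * (2 : ℝ) ^ ((2 ^ (d + 1) + 2) ^ d * L ^ d)) ≤ A ^ ((1 + 1 / ((2 * (2 ^ d + 1) + 6 : ℝ) ^ d)) - 1 : ℝ)) :
    WeakNormLE (abkmNormParams L N Mord R p r₀ h θbar A (schedDelta δ₀ δ₁ N) 𝒞) (k + 1)
      (fun U φ => nextK D.s (reblock D.s (D.L * D.s)) (stepMeasure D.𝒞) (expNegH H) (expNegH Ht) K U φ - nextKStep D H K U φ)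
      (        ((L ^ d : ℕ) : ℝ) * κ₁ ^ (L ^ d) *
        (16 * Real.exp (3 / 8) * hamNorm (fieldWt h (L : ℝ) d k) ((L : ℝ) ^ k) (L ^ (d * k)) (Ht - nextH D H K) *
            ((1 + 8 * pi2BoundConst d (((2 * R + 2 : ℕ) : ℝ) + ((d / 2 + 1 : ℕ) : ℝ))) * (C * A𝒫a * A⁻¹) +
              256 * Real.exp (1 / 4) * ((A𝒫a + 4) * b ^ 2 +
                2 * b * (pi2BoundConst d (((2 * R + 2 : ℕ) : ℝ) + ((d / 2 + 1 : ℕ) : ℝ)) * (C * A𝒫a * A⁻¹)) +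
                (pi2BoundConst d (((2 * R + 2 : ℕ) : ℝ) + ((d / 2 + 1 : ℕ) : ℝ)) * (C * A𝒫a * A⁻¹)) ^ 2)) +
          16 * Real.exp (3 / 8) * τ *
            ((1 + 8 * pi2BoundConst d (((2 * R + 2 : ℕ) : ℝ) + ((d / 2 + 1 : ℕ) : ℝ))) * ((0 : ℝ) * A𝒫a * A⁻¹)) +
          (512 * Real.exp (1 / 4) * (A𝒫a + 4) * (b + b) *
              hamNorm (fieldWt h (L : ℝ) d k) ((L : ℝ) ^ k) (L ^ (d * k)) (H - H) +
            512 * Real.exp (1 / 4) *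
              (hamNorm (fieldWt h (L : ℝ) d k) ((L : ℝ) ^ k) (L ^ (d * k)) (H - H) *
                  (pi2BoundConst d (((2 * R + 2 : ℕ) : ℝ) + ((d / 2 + 1 : ℕ) : ℝ)) * (C * A𝒫a * A⁻¹)) +
                b * (pi2BoundConst d (((2 * R + 2 : ℕ) : ℝ) + ((d / 2 + 1 : ℕ) : ℝ)) * ((0 : ℝ) * A𝒫a * A⁻¹))) +
            256 * Real.exp (1 / 4) *
              (pi2BoundConst d (((2 * R + 2 : ℕ) : ℝ) + ((d / 2 + 1 : ℕ) : ℝ)) * (C * A𝒫a * A⁻¹) +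
                pi2BoundConst d (((2 * R + 2 : ℕ) : ℝ) + ((d / 2 + 1 : ℕ) : ℝ)) * ((0 : ℝ) * A𝒫a * A⁻¹)) *
              (pi2BoundConst d (((2 * R + 2 : ℕ) : ℝ) + ((d / 2 + 1 : ℕ) : ℝ)) * ((0 : ℝ) * A𝒫a * A⁻¹)))) * A +
        (((3 * (16 * Real.exp (3 / 8) * hamNorm (fieldWt h (L : ℝ) d k) ((L : ℝ) ^ k) (L ^ (d * k)) (Ht - nextH D H K)) +
              16 * Real.exp (3 / 8) * hamNorm (fieldWt h (L : ℝ) d k) ((L : ℝ) ^ k) (L ^ (d * k)) (H - H) + (0 : ℝ)) *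
            (ω * A ^ 4)) + (2 * (16 * Real.exp (3 / 8) * hamNorm (fieldWt h (L : ℝ) d k) ((L : ℝ) ^ k) (L ^ (d * k)) (Ht - nextH D H K)) + (0 : ℝ))) +
        ((3 * (16 * Real.exp (3 / 8) * hamNorm (fieldWt h (L : ℝ) d k) ((L : ℝ) ^ k) (L ^ (d * k)) (Ht - nextH D H K)) +
              16 * Real.exp (3 / 8) * hamNorm (fieldWt h (L : ℝ) d k) ((L : ℝ) ^ k) (L ^ (d * k)) (H - H) + (0 : ℝ)) *
            (ω * A ^ 4)) +
        ((3 * (16 * Real.exp (3 / 8) * hamNorm (fieldWt h (L : ℝ) d k) ((L : ℝ) ^ k) (L ^ (d * k)) (Ht - nextH D H K)) +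
              16 * Real.exp (3 / 8) * hamNorm (fieldWt h (L : ℝ) d k) ((L : ℝ) ^ k) (L ^ (d * k)) (H - H) + (0 : ℝ)) *
            (ω * A ^ 4)) +
        ((L ^ d : ℕ) : ℝ) * κ₁ ^ (L ^ d) *
        (16 * Real.exp (3 / 8) *
          hamNorm (fieldWt h (L : ℝ) d k) ((L : ℝ) ^ k) (L ^ (d * k)) (nextH D H K - Ht)) * A) := by
  set P := abkmNormParams L N Mord R p r₀ h θbar A (schedDelta δ₀ δ₁ N) 𝒞 with hP
  -- sizes and derived hypotheses
  have hd2 : 2 ≤ d := by omega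
  have hp1 : d / 2 + 1 ≤ p := by omega
  have hpR : p ≤ R := by omega
  have hMord : d / 2 + 1 ≤ Mord := by omega
  have hr₀2 : 2 ≤ r₀ := by omega
  have hL0 : (0 : ℝ) < L := by exact_mod_cast hLodd.pos
  have hA0 : 0 < A := by linarith
  have h𝔥 : 0 < fieldWt h (L : ℝ) d k := fieldWt_pos hh hL0 d k
  have hRk : (0 : ℝ) < (L : ℝ) ^ k := by positivity
  have hnn : ∀ G : RelevantHamiltonian ℂ d, 0 ≤ hamNorm (fieldWt h (L : ℝ) d k) ((L : ℝ) ^ k) (L ^ (d * k)) G := fun G => hamNorm_nonneg h𝔥.le hRk.le _ _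
  have hb0 : 0 ≤ b := (hnn H).trans hH
  have hH64 : hamNorm (fieldWt h (L : ℝ) d k) ((L : ℝ) ^ k) (L ^ (d * k)) H ≤ 1 / 64 := hH.trans hb
  have hH16 : hamNorm (fieldWt h (L : ℝ) d k) ((L : ℝ) ^ k) (L ^ (d * k)) H ≤ 1 / 16 := hH64.trans (by norm_num)
  have hH8 : hamNorm (fieldWt h (L : ℝ) d k) ((L : ℝ) ^ k) (L ^ (d * k)) H ≤ 1 / 8 := hH64.trans (by norm_num)
  have hHH : hamNorm (fieldWt h (L : ℝ) d k) ((L : ℝ) ^ k) (L ^ (d * k)) (H - H) = 0 := by rw [sub_self, hamNorm_zero]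
  have hHta : hamNorm (fieldWt h (L : ℝ) d k) ((L : ℝ) ^ k) (L ^ (d * k)) (nextH D H K) ≤ τ :=
    (hamNorm_nextH_abkm_le_of_stepKernelBounds hd2 hLodd hL hM hkN hp1 hpR hr₀2 hB hh hh2a hA1 D hS hB₀ hc₀ H hC hK hKd
      hKloc).trans (by linarith [hH])
  have hHta16 : hamNorm (fieldWt h (L : ℝ) d k) ((L : ℝ) ^ k) (L ^ (d * k)) (nextH D H K) ≤ 1 / 16 := hHta.trans hτ
  have hHt16 : hamNorm (fieldWt h (L : ℝ) d k) ((L : ℝ) ^ k) (L ^ (d * k)) Ht ≤ 1 / 16 := hHt.trans hτ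
  have hKK : WeakNormLE P k (K - K) 0 := by
    intro X hX hc φ
    have hz : (K - K) X = fun _ => (0 : ℂ) := by funext ψ; simp
    rw [hz, tayNorm_const, norm_zero]
    exact mul_nonneg (mul_nonneg le_rfl (WeakNormLE.aFactor_pos hA0 k X).le) ((abkmWeightData L N Mord R θbar (schedDelta δ₀ δ₁ N) 𝒞).weight_pos k X φ).le
  have hCΔ : (0 : ℝ) ≤ 0 := le_rfl
  have hbω : 8 * Real.exp (1 / 4) * hamNorm (fieldWt h (L : ℝ) d k) ((L : ℝ) ^ k) (L ^ (d * k)) H ≤ ω := by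
    have : 8 * Real.exp (1 / 4) * hamNorm (fieldWt h (L : ℝ) d k) ((L : ℝ) ^ k) (L ^ (d * k)) H ≤ 8 * Real.exp (1 / 4) * b := mul_le_mul_of_nonneg_left hH (by positivity)
    have : 0 ≤ 8 * Real.exp (1 / 4) * b := by positivity
    linarith
  have hb'ω : 8 * Real.exp (1 / 4) * hamNorm (fieldWt h (L : ℝ) d k) ((L : ℝ) ^ k) (L ^ (d * k)) H + 16 * Real.exp (3 / 8) * hamNorm (fieldWt h (L : ℝ) d k) ((L : ℝ) ^ k) (L ^ (d * k)) (H - H) ≤ ω := by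
    rw [hHH, mul_zero, add_zero]; exact hbω
  have hCω : C + (0 : ℝ) ≤ ω := by linarith
  have hκ₁'' : 1 + Real.exp (1 / 4) ≤ κ₁ := by
    have : 0 ≤ 16 * Real.exp (3 / 8) * τ := by
      have := (hnn Ht).trans hHt
      positivity
    linarith
  have hκ' : 1 + Real.exp (1 / 4) ≤ κ := by
    have : 0 ≤ 16 * Real.exp (3 / 8) * hamNorm (fieldWt h (L : ℝ) d k) ((L : ℝ) ^ k) (L ^ (d * k)) (Ht - nextH D H K) := mul_nonneg (by positivity) (hnn _)
    linarith
  intro U hU hUc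
  have hUne : U.Nonempty := hUc.1
  -- the five pieces (Σ₁ and the defect in block form)
  have h1 := tayNormLE_remainderOne_sub_abkm_blockFree_of_stepKernelBounds (p := p) (r₀ := r₀) (A := A) hd hLodd hL hR2 hM hkN hp1
    hpR hMord hr₀2 hB hδ₀ hδ₁ hh hh0 hh2a hA𝒫a hA1 D hDs hDL hS hB₀ hc₀ hU hHt hHta hτ hH hH hb hC hCΔ hK hK hKK hKd hKd hKloc
    hKloc hva hκ₁ hκ₁'
  have h2 := tayNormLE_remainderTwoLarge_sub_abkm_of_stepKernelBounds (n := n) (lam := lam) (μ := μ) hd hLodd hL hR2 hM hkN hS hp1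
    hMord hB hδ₀ hδ₁ hh hh0 hA𝒫a hA1 hU hHt hHta hτ hH16 hH16 hC hCΔ hK hK hKK hKfac hK0 hKd hKfac hK0 hKd hKloc hKloc
    hω1 hbω hb'ω hCω hωA hκ
  have h3 := tayNormLE_remainderThree_sub_abkm_of_stepKernelBounds (n := n) (lam := lam) (μ := μ) hd hLodd hL hR2 hM hkN hS hp1
    hMord hB hδ₀ hδ₁ hh hh0 hA𝒫a hA1 hU hUne hHt hHta hτ hH16 hH16 hC hCΔ hK hK hKK hKfac hK0 hKd hKfac hK0 hKd hKloc hKloc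
    hω1 hbω hb'ω hCω hωA hκ
  have h4 := tayNormLE_remainderFour_sub_abkm_of_stepKernelBounds (n := n) (lam := lam) (μ := μ) hd hLodd hL hR2 hM hkN hS hp1
    hMord hB hδ₀ hδ₁ hh hh0 hA𝒫a hA1 hU hHt hHta hτ hH16 hH16 hC hCΔ hK hK hKK hKfac hK0 hKd hKfac hK0 hKd hKloc hKloc
    hω1 hbω hb'ω hCω hωA hκ
  have h5 := tayNormLE_blockDefect_sub_abkm_blockFree (n := n) (lam := lam) (μ := μ) (A𝒫 := A𝒫) (p := p) (r₀ := r₀) (A := A) hd hLodd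
    hL hR2 hM hkN hp1 hMord hB hδ₀ hδ₁ hh hh0 hA1 D hDs hDL hU (Ht := Ht) (H₁ := nextH D H K) (H₂ := Ht) hHt hτ hHta16 hHt16 hκ₁''
  have hglue := tayNormLE_nextK_freeHt_sub_nextKStep_of_pieces (n := n) (lam := lam) (μ := μ) hd2 hLodd hL hM hkN hp1 hpR hMord hB
    hδ₀ hδ₁ hh hh0 hA0 D hDs hDL hS hB₀ hc₀ hH8 Ht hC hK hKfac hK0 hKd hKloc hUne h1 h2 h3 h4 h5
  refine hglue.mono ?_ fun φ => ((abkmWeightData L N Mord R θbar (schedDelta δ₀ δ₁ N) 𝒞).weight_pos (k + 1) U φ).le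
  -- block counts: `|U|_k = L^d |U|_{k+1}`, `|U|_{k+1} ≥ 1`, `aFactor = (A^u)⁻¹`
  have hsodd : Odd (L ^ k) := hLodd.pow
  have hMeq : M = L * L ^ k * L ^ (N - k - 1) := by
    rw [hM, ← pow_succ', ← pow_add]; congr 1; omega
  have hUm : IsPolymer (L * L ^ k) U := by rw [← pow_succ']; exact hU
  have hm0 : (blocks (L ^ k) U).card = L ^ d * (blocks (L * L ^ k) U).card :=
    TorusPolymer.card_blocks_eq_mul hMeq hsodd hLodd hLodd.pow hUm
  have hm1 : 1 ≤ (blocks (L * L ^ k) U).card := by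
    obtain ⟨u, hu⟩ := hUc.1
    exact card_pos.2 ⟨blockOf (L * L ^ k) u, mem_blocks.2 ⟨u, hu, rfl⟩⟩
  have haF : (abkmNormParams L N Mord R p r₀ h θbar A (schedDelta δ₀ δ₁ N) 𝒞).aFactor (k + 1) U =
      (A ^ (blocks (L * L ^ k) U).card)⁻¹ := by
    show (A ^ numBlocks (L ^ (k + 1)) U)⁻¹ = _
    rw [← card_blocks_eq_numBlocks, pow_succ']
  rw [haF]
  -- nonnegativity of the letters
  have he38 : 0 ≤ 16 * Real.exp (3 / 8) := by positivity
  have hDt0 : 0 ≤ 16 * Real.exp (3 / 8) * hamNorm (fieldWt h (L : ℝ) d k) ((L : ℝ) ^ k) (L ^ (d * k)) (Ht - nextH D H K) := mul_nonneg he38 (hnn _)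
  have hHH0' : 0 ≤ hamNorm (fieldWt h (L : ℝ) d k) ((L : ℝ) ^ k) (L ^ (d * k)) (H - H) := hnn _
  have hnH := hnn H
  have hω0 : 0 ≤ ω := le_trans hC hω3
  have hκ0 : 0 ≤ κ := by linarith [hκ', Real.exp_pos (1 / 4)]
  have hE0 : 0 ≤ ((3 * (16 * Real.exp (3 / 8) * hamNorm (fieldWt h (L : ℝ) d k) ((L : ℝ) ^ k) (L ^ (d * k)) (Ht - nextH D H K)) +
              16 * Real.exp (3 / 8) * hamNorm (fieldWt h (L : ℝ) d k) ((L : ℝ) ^ k) (L ^ (d * k)) (H - H) + (0 : ℝ)) *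
            (ω * A ^ 4)) := by positivity
  have hEp0 : 0 ≤ (2 * (16 * Real.exp (3 / 8) * hamNorm (fieldWt h (L : ℝ) d k) ((L : ℝ) ^ k) (L ^ (d * k)) (Ht - nextH D H K)) + (0 : ℝ)) := by positivity
  have hX3a0 : 0 ≤ κ ^ (L ^ d) * ((2 * (2 * κ * max 1 A𝒫a)) ^ ((2 ^ (d + 1) + 2) ^ d * L ^ d) * (4 : ℝ) ^ ((2 ^ (d + 1) + 2) ^ d * L ^ d)) := by positivity
  have hX2a0 : 0 ≤ κ ^ (L ^ d) * ((2 * κ * max 1 A𝒫a) ^ ((2 ^ (d + 1) + 2) ^ d * L ^ d) * (2 : ℝ) ^ ((2 ^ (d + 1) + 2) ^ d * L ^ d)) := by positivity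
  have hAu0 : 0 ≤ (A ^ (blocks (L * L ^ k) U).card)⁻¹ := by positivity
  -- the gains
  have g3a : κ ^ (blocks (L ^ k) U).card * (((2 * (2 * κ * max 1 A𝒫a)) ^ ((2 ^ (d + 1) + 2) ^ d * L ^ d) * (4 : ℝ) ^ ((2 ^ (d + 1) + 2) ^ d * L ^ d)) ^ (blocks (L * L ^ k) U).card * A ^ (-((1 + 1 / ((2 * (2 ^ d + 1) + 6 : ℝ) ^ d)) * (blocks (L * L ^ k) U).card) : ℝ)) ≤ (A ^ (blocks (L * L ^ k) U).card)⁻¹ := by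
    rw [hm0, pow_mul, ← mul_assoc, ← mul_pow]
    exact TorusPolymer.pow_mul_rpow_le_inv_pow' hA1 hX3a0 hc3a hm1
  have g2a : κ ^ (blocks (L ^ k) U).card * (((2 * κ * max 1 A𝒫a) ^ ((2 ^ (d + 1) + 2) ^ d * L ^ d) * (2 : ℝ) ^ ((2 ^ (d + 1) + 2) ^ d * L ^ d)) ^ (blocks (L * L ^ k) U).card * A ^ (-((1 + 1 / ((2 * (2 ^ d + 1) + 6 : ℝ) ^ d)) * (blocks (L * L ^ k) U).card) : ℝ)) ≤ (A ^ (blocks (L * L ^ k) U).card)⁻¹ := by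
    rw [hm0, pow_mul, ← mul_assoc, ← mul_pow]
    exact TorusPolymer.pow_mul_rpow_le_inv_pow' hA1 hX2a0 hc2a hm1
  -- termwise bounds
  have e3 : ∀ (E : ℝ), 0 ≤ E → κ ^ (blocks (L ^ k) U).card * E * (((2 * (2 * κ * max 1 A𝒫a)) ^ ((2 ^ (d + 1) + 2) ^ d * L ^ d) * (4 : ℝ) ^ ((2 ^ (d + 1) + 2) ^ d * L ^ d)) ^ (blocks (L * L ^ k) U).card * A ^ (-((1 + 1 / ((2 * (2 ^ d + 1) + 6 : ℝ) ^ d)) * (blocks (L * L ^ k) U).card) : ℝ)) ≤ E * (A ^ (blocks (L * L ^ k) U).card)⁻¹ := by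
    intro E hE
    calc κ ^ (blocks (L ^ k) U).card * E * (((2 * (2 * κ * max 1 A𝒫a)) ^ ((2 ^ (d + 1) + 2) ^ d * L ^ d) * (4 : ℝ) ^ ((2 ^ (d + 1) + 2) ^ d * L ^ d)) ^ (blocks (L * L ^ k) U).card * A ^ (-((1 + 1 / ((2 * (2 ^ d + 1) + 6 : ℝ) ^ d)) * (blocks (L * L ^ k) U).card) : ℝ)) = E * (κ ^ (blocks (L ^ k) U).card * (((2 * (2 * κ * max 1 A𝒫a)) ^ ((2 ^ (d + 1) + 2) ^ d * L ^ d) * (4 : ℝ) ^ ((2 ^ (d + 1) + 2) ^ d * L ^ d)) ^ (blocks (L * L ^ k) U).card * A ^ (-((1 + 1 / ((2 * (2 ^ d + 1) + 6 : ℝ) ^ d)) * (blocks (L * L ^ k) U).card) : ℝ))) := by ring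
      _ ≤ E * (A ^ (blocks (L * L ^ k) U).card)⁻¹ := mul_le_mul_of_nonneg_left g3a hE
  have e2 : ∀ (E : ℝ), 0 ≤ E → κ ^ (blocks (L ^ k) U).card * E * (((2 * κ * max 1 A𝒫a) ^ ((2 ^ (d + 1) + 2) ^ d * L ^ d) * (2 : ℝ) ^ ((2 ^ (d + 1) + 2) ^ d * L ^ d)) ^ (blocks (L * L ^ k) U).card * A ^ (-((1 + 1 / ((2 * (2 ^ d + 1) + 6 : ℝ) ^ d)) * (blocks (L * L ^ k) U).card) : ℝ)) ≤ E * (A ^ (blocks (L * L ^ k) U).card)⁻¹ := by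
    intro E hE
    calc κ ^ (blocks (L ^ k) U).card * E * (((2 * κ * max 1 A𝒫a) ^ ((2 ^ (d + 1) + 2) ^ d * L ^ d) * (2 : ℝ) ^ ((2 ^ (d + 1) + 2) ^ d * L ^ d)) ^ (blocks (L * L ^ k) U).card * A ^ (-((1 + 1 / ((2 * (2 ^ d + 1) + 6 : ℝ) ^ d)) * (blocks (L * L ^ k) U).card) : ℝ)) = E * (κ ^ (blocks (L ^ k) U).card * (((2 * κ * max 1 A𝒫a) ^ ((2 ^ (d + 1) + 2) ^ d * L ^ d) * (2 : ℝ) ^ ((2 ^ (d + 1) + 2) ^ d * L ^ d)) ^ (blocks (L * L ^ k) U).card * A ^ (-((1 + 1 / ((2 * (2 ^ d + 1) + 6 : ℝ) ^ d)) * (blocks (L * L ^ k) U).card) : ℝ))) := by ring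
      _ ≤ E * (A ^ (blocks (L * L ^ k) U).card)⁻¹ := mul_le_mul_of_nonneg_left g2a hE
  have t1 : ((L ^ d : ℕ) : ℝ) * κ₁ ^ (L ^ d) *
        (16 * Real.exp (3 / 8) * hamNorm (fieldWt h (L : ℝ) d k) ((L : ℝ) ^ k) (L ^ (d * k)) (Ht - nextH D H K) *
            ((1 + 8 * pi2BoundConst d (((2 * R + 2 : ℕ) : ℝ) + ((d / 2 + 1 : ℕ) : ℝ))) * (C * A𝒫a * A⁻¹) +
              256 * Real.exp (1 / 4) * ((A𝒫a + 4) * b ^ 2 +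
                2 * b * (pi2BoundConst d (((2 * R + 2 : ℕ) : ℝ) + ((d / 2 + 1 : ℕ) : ℝ)) * (C * A𝒫a * A⁻¹)) +
                (pi2BoundConst d (((2 * R + 2 : ℕ) : ℝ) + ((d / 2 + 1 : ℕ) : ℝ)) * (C * A𝒫a * A⁻¹)) ^ 2)) +
          16 * Real.exp (3 / 8) * τ *
            ((1 + 8 * pi2BoundConst d (((2 * R + 2 : ℕ) : ℝ) + ((d / 2 + 1 : ℕ) : ℝ))) * ((0 : ℝ) * A𝒫a * A⁻¹)) +
          (512 * Real.exp (1 / 4) * (A𝒫a + 4) * (b + b) *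
              hamNorm (fieldWt h (L : ℝ) d k) ((L : ℝ) ^ k) (L ^ (d * k)) (H - H) +
            512 * Real.exp (1 / 4) *
              (hamNorm (fieldWt h (L : ℝ) d k) ((L : ℝ) ^ k) (L ^ (d * k)) (H - H) *
                  (pi2BoundConst d (((2 * R + 2 : ℕ) : ℝ) + ((d / 2 + 1 : ℕ) : ℝ)) * (C * A𝒫a * A⁻¹)) +
                b * (pi2BoundConst d (((2 * R + 2 : ℕ) : ℝ) + ((d / 2 + 1 : ℕ) : ℝ)) * ((0 : ℝ) * A𝒫a * A⁻¹))) +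
            256 * Real.exp (1 / 4) *
              (pi2BoundConst d (((2 * R + 2 : ℕ) : ℝ) + ((d / 2 + 1 : ℕ) : ℝ)) * (C * A𝒫a * A⁻¹) +
                pi2BoundConst d (((2 * R + 2 : ℕ) : ℝ) + ((d / 2 + 1 : ℕ) : ℝ)) * ((0 : ℝ) * A𝒫a * A⁻¹)) *
              (pi2BoundConst d (((2 * R + 2 : ℕ) : ℝ) + ((d / 2 + 1 : ℕ) : ℝ)) * ((0 : ℝ) * A𝒫a * A⁻¹)))) *
        (A * (A ^ (blocks (L * L ^ k) U).card)⁻¹) ≤ ((L ^ d : ℕ) : ℝ) * κ₁ ^ (L ^ d) *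
        (16 * Real.exp (3 / 8) * hamNorm (fieldWt h (L : ℝ) d k) ((L : ℝ) ^ k) (L ^ (d * k)) (Ht - nextH D H K) *
            ((1 + 8 * pi2BoundConst d (((2 * R + 2 : ℕ) : ℝ) + ((d / 2 + 1 : ℕ) : ℝ))) * (C * A𝒫a * A⁻¹) +
              256 * Real.exp (1 / 4) * ((A𝒫a + 4) * b ^ 2 +
                2 * b * (pi2BoundConst d (((2 * R + 2 : ℕ) : ℝ) + ((d / 2 + 1 : ℕ) : ℝ)) * (C * A𝒫a * A⁻¹)) +
                (pi2BoundConst d (((2 * R + 2 : ℕ) : ℝ) + ((d / 2 + 1 : ℕ) : ℝ)) * (C * A𝒫a * A⁻¹)) ^ 2)) +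
          16 * Real.exp (3 / 8) * τ *
            ((1 + 8 * pi2BoundConst d (((2 * R + 2 : ℕ) : ℝ) + ((d / 2 + 1 : ℕ) : ℝ))) * ((0 : ℝ) * A𝒫a * A⁻¹)) +
          (512 * Real.exp (1 / 4) * (A𝒫a + 4) * (b + b) *
              hamNorm (fieldWt h (L : ℝ) d k) ((L : ℝ) ^ k) (L ^ (d * k)) (H - H) +
            512 * Real.exp (1 / 4) *
              (hamNorm (fieldWt h (L : ℝ) d k) ((L : ℝ) ^ k) (L ^ (d * k)) (H - H) *
                  (pi2BoundConst d (((2 * R + 2 : ℕ) : ℝ) + ((d / 2 + 1 : ℕ) : ℝ)) * (C * A𝒫a * A⁻¹)) +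
                b * (pi2BoundConst d (((2 * R + 2 : ℕ) : ℝ) + ((d / 2 + 1 : ℕ) : ℝ)) * ((0 : ℝ) * A𝒫a * A⁻¹))) +
            256 * Real.exp (1 / 4) *
              (pi2BoundConst d (((2 * R + 2 : ℕ) : ℝ) + ((d / 2 + 1 : ℕ) : ℝ)) * (C * A𝒫a * A⁻¹) +
                pi2BoundConst d (((2 * R + 2 : ℕ) : ℝ) + ((d / 2 + 1 : ℕ) : ℝ)) * ((0 : ℝ) * A𝒫a * A⁻¹)) *
              (pi2BoundConst d (((2 * R + 2 : ℕ) : ℝ) + ((d / 2 + 1 : ℕ) : ℝ)) * ((0 : ℝ) * A𝒫a * A⁻¹)))) * A * (A ^ (blocks (L * L ^ k) U).card)⁻¹ := le_of_eq (by ring)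
  have t5 : ((L ^ d : ℕ) : ℝ) * κ₁ ^ (L ^ d) *
        (16 * Real.exp (3 / 8) *
          hamNorm (fieldWt h (L : ℝ) d k) ((L : ℝ) ^ k) (L ^ (d * k)) (nextH D H K - Ht)) *
        (A * (A ^ (blocks (L * L ^ k) U).card)⁻¹) ≤ ((L ^ d : ℕ) : ℝ) * κ₁ ^ (L ^ d) *
        (16 * Real.exp (3 / 8) *
          hamNorm (fieldWt h (L : ℝ) d k) ((L : ℝ) ^ k) (L ^ (d * k)) (nextH D H K - Ht)) * A * (A ^ (blocks (L * L ^ k) U).card)⁻¹ := le_of_eq (by ring)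
  have t2 := add_le_add (e3 _ hE0) (e2 _ hEp0)
  have t3 := e3 _ hE0
  have t4 := e3 _ hE0
  refine (add_le_add (add_le_add (add_le_add (add_le_add t1 t2) t3) t4) t5).trans (le_of_eq ?_)
  ring

end Literature.MathematicalPhysics.StatisticalMechanics.GradientRG

end
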